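import Summits.QuantumFields.GaugeBoot.StrongCouplingReadOnce
import Summits.QuantumFields.GaugeBoot.StrongCouplingPlaquetteEdges
import HarnessLib

/-!
# Strong coupling from the loop equation: the level-3 words of the plaquette iteration are `O(β)` (gauge-boot, ADDENDUM 24 part D)

HONEST FRAMING (cell `pub-gaugeboot`, page 1 of every file): the venture produces certified bounds
on lattice expectations at stated coupling, gauge group, dimension and torus size; NOT a mass gap,
NOT a continuum limit, NOT a string tension; NOT Yang–Mills-summit-bearing (barriers
`FixedCouplingUltralocality`, `PerturbativeInvisibility`).  Crude explicit `O(β)` bounds on a finite torus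
`(ℤ/L)^d`, `L ≥ 2`, every real `β` (tree coupling); no number of the cell's tables is certified here.

## Content (`SU(N)`, `N ≥ 2`, fundamental representation)

Third loop-equation step for the plaquette `P̃₀ = plaqWord μ ν₀ true` at `x` (ADDENDUM 24).  With `q = plaqWord μ ν ε`
another plaquette word through `(x, μ)` (`(ν, ε) ≠ (ν₀, +)`), `w ∈ {q, q⁻¹}`, `y = x + e_μ`,
`rot w = +ν₀ −μ −ν₀ · w · +μ` (read from `y`; `tr hol_y(rot w) = tr hol_x(P̃₀ · w)`), `P̃₀ʸ = plaqWord ν₀ μ false` (the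
marked plaquette re-based at `y`) and `Q ∈ {plaqWord ν₀ ν' ε', its reverse}` (`ν' ≠ ν₀`) a plaquette word through
`(y, ν₀)`, every expectation met by the level-2 loop equations of `E[tr hol(P̃₀·w)]` and `E[tr U_P · tr hol w]` is
`O(β)` with the read-once constant `C₀ = 4(d−1)N²|β|/(N²−1)` of `StrongCouplingReadOnce`:

* `norm_integral_trace_rot_append_le` — ★ `‖E[tr hol_y(rot w · Q)]‖ ≤ C₀` (the 12-letter words; marked link
  `qEdge`, or `qEdge'` when `Q` is the plaquette `(ν', ε') = (ν, ε)` sharing `qEdge`);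
* `norm_integral_trace_rot_mul_trace_le` — ★ `‖E[tr hol_y(rot w) · tr hol_y Q]‖ ≤ C₀·N`;
* `norm_integral_trace_rebased_append_mul_trace_le` — ★ `‖E[tr hol_y(P̃₀ʸ · Q) · tr hol_x w]‖ ≤ C₀·N`;
* `norm_integral_trace_rebased_mul_trace_mul_trace_le` — ★ `‖E[tr hol_y P̃₀ʸ · tr hol_y Q · tr hol_x w]‖ ≤ C₀·N²`;
* the generic forms `norm_integral_trace_qw_mul_le` (marked `w`) and `norm_integral_trace_plaqWord_append_qw_mul_le`
  (marked `P̃₀ · w`) with an arbitrary multiplier ignoring `qEdge`, and the bookkeeping of multipliers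
  (`mulData_trace`, `mulData_mul`), plus the read-once counts of the composite words.

References: Yu. Makeenko, *Methods of contemporary gauge theory* (2002) Problem 12.7.  Everything is `[folklore]`.
-/

noncomputable section

open MeasureTheory Filter Topology NormedSpace
open scoped Matrix.Norms.Frobenius Matrix
open Literature.MathematicalPhysics.QuantumFieldTheory Literature.MathematicalPhysics.QuantumLattice
open Summit.QuantumFields.YangMills.Cruxes.CurvatureAmnesia.WardDefect.SchwingerDyson

namespace Summit.QuantumFields.GaugeBoot

namespace StrongCoupling

variable {d L N : ℕ}

/-! ## Read-once counts of the composite words -/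

section CompositeCounts

variable [NeZero L]


omit [NeZero L] in
/-- Endpoint of `q^{±1}`: back at `x`. [folklore] -/
theorem endpoint_qw (x : Site d L) {μ ν : Fin d} (ε : Bool) {w : Word d}
    (hw : w = plaqWord μ ν ε ∨ w = (plaqWord μ ν ε).reverse) :
    Word.endpoint x w = x := by
  rcases hw with rfl | rfl
  · exact endpoint_plaqWord x μ ν ε
  · have h := Word.endpoint_reverse x (plaqWord μ ν ε)
    rwa [endpoint_plaqWord] at h

/-- ★ **`P̃₀ · q^{±1}` reads `qEdge` exactly once.** [folklore] -/
theorem count_qEdge_plaqWord_append (hL : (1 : ZMod L) ≠ 0) (x : Site d L) {μ ν₀ ν : Fin d} (hμν₀ : μ ≠ ν₀)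
    (hνμ : ν ≠ μ) {ε : Bool} (hne : ¬(ν = ν₀ ∧ ε = true)) {w : Word d}
    (hw : w = plaqWord μ ν ε ∨ w = (plaqWord μ ν ε).reverse) :
    (Word.edgesRead x (plaqWord μ ν₀ true ++ w)).count (qEdge x μ ν ε) = 1 := by
  rw [Word.edgesRead_append, endpoint_plaqWord, List.count_append,
    List.count_eq_zero_of_not_mem (qEdge_not_mem_plaqWordZero hL x hμν₀ hνμ hne).1,
    count_qEdge_eq_one hL x hνμ ε hw]

/-- ★ **`P̃₀ · q^{±1}` reads `qEdge'` exactly once** (`ν ≠ ν₀`). [folklore] -/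
theorem count_qEdge'_plaqWord_append (hL : (1 : ZMod L) ≠ 0) (x : Site d L) {μ ν₀ ν : Fin d} (hμν₀ : μ ≠ ν₀)
    (hνμ : ν ≠ μ) (ε : Bool) (hνν₀ : ν ≠ ν₀) {w : Word d}
    (hw : w = plaqWord μ ν ε ∨ w = (plaqWord μ ν ε).reverse) :
    (Word.edgesRead x (plaqWord μ ν₀ true ++ w)).count (qEdge' x μ ν ε) = 1 := by
  rw [Word.edgesRead_append, endpoint_plaqWord, List.count_append,
    List.count_eq_zero_of_not_mem (qEdge'_not_mem_plaqWordZero hL x hμν₀ ε hνν₀).1,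
    count_qEdge'_eq_one hL x hνμ ε hw]

omit [NeZero L] in
/-- The edges of the rotated deformed word followed by `Q`: `(+ν₀ −μ −ν₀ · w · +μ) · Q` read from `x + e_μ`, for `w`
closed at `x`. [folklore] -/
theorem edgesRead_rot_append (x : Site d L) (μ ν₀ : Fin d) {w : Word d} (hwx : Word.endpoint x w = x) (Q : Word d) :
    Word.edgesRead (x.shift μ) ((.fwd ν₀ :: .bwd μ :: .bwd ν₀ :: (w ++ [.fwd μ])) ++ Q) =
      [(x.shift μ, ν₀), (x.shift ν₀, μ), (x, ν₀)] ++ Word.edgesRead x w ++ [(x, μ)] ++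
        Word.edgesRead (x.shift μ) Q := by
  have e1 : (x.shift μ).shift ν₀ - Pi.single μ 1 = x.shift ν₀ := by simp only [Site.shift]; abel
  have e2 : x.shift ν₀ - Pi.single ν₀ 1 = x := by simp [Site.shift]
  have hend : Word.endpoint (x.shift μ) (.fwd ν₀ :: .bwd μ :: .bwd ν₀ :: (w ++ [.fwd μ]) : Word d) = x.shift μ :=
    endpoint_rot x μ ν₀ w hwx
  rw [Word.edgesRead_append, hend]
  simp only [List.cons_append, Word.edgesRead_cons, Step.edge_fwd, Step.edge_bwd, Step.apply_fwd, Step.apply_bwd, e1, e2,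
    Word.edgesRead_append, hwx, Word.edgesRead_nil, List.nil_append, List.append_assoc]

/-- ★ **The level-3 words `(+ν₀ −μ −ν₀ · q^{±1} · +μ) · Q` read `qEdge` exactly once** whenever `Q` (a word read from
`x + e_μ`) does not read it. [folklore] -/
theorem count_rot_append_eq_one (hL : (1 : ZMod L) ≠ 0) (x : Site d L) {μ ν₀ ν : Fin d} (hμν₀ : μ ≠ ν₀) (hνμ : ν ≠ μ)
    {ε : Bool} (hne : ¬(ν = ν₀ ∧ ε = true)) {w : Word d}
    (hw : w = plaqWord μ ν ε ∨ w = (plaqWord μ ν ε).reverse) {Q : Word d}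
    (hQ : qEdge x μ ν ε ∉ Word.edgesRead (x.shift μ) Q) :
    (Word.edgesRead (x.shift μ) ((.fwd ν₀ :: .bwd μ :: .bwd ν₀ :: (w ++ [.fwd μ])) ++ Q)).count (qEdge x μ ν ε) = 1 := by
  obtain ⟨h1, h2, h3, h4⟩ := qEdge_ne_four hL x hμν₀ hνμ hne
  rw [edgesRead_rot_append x μ ν₀ (endpoint_qw x ε hw) Q]
  simp only [List.count_append, List.count_cons, List.count_nil, count_qEdge_eq_one hL x hνμ ε hw,
    List.count_eq_zero_of_not_mem hQ, beq_iff_eq, Ne.symm h1, Ne.symm h2, Ne.symm h3, Ne.symm h4, if_false]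

/-- ★ **… and read `qEdge'` exactly once** whenever `Q` does not read it (`ν ≠ ν₀`). [folklore] -/
theorem count_rot_append_eq_one' (hL : (1 : ZMod L) ≠ 0) (x : Site d L) {μ ν₀ ν : Fin d} (hμν₀ : μ ≠ ν₀) (hνμ : ν ≠ μ)
    (ε : Bool) (hνν₀ : ν ≠ ν₀) {w : Word d}
    (hw : w = plaqWord μ ν ε ∨ w = (plaqWord μ ν ε).reverse) {Q : Word d}
    (hQ : qEdge' x μ ν ε ∉ Word.edgesRead (x.shift μ) Q) :
    (Word.edgesRead (x.shift μ) ((.fwd ν₀ :: .bwd μ :: .bwd ν₀ :: (w ++ [.fwd μ])) ++ Q)).count (qEdge' x μ ν ε) = 1 := by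
  obtain ⟨h1, h2, h3, h4⟩ := qEdge'_ne_four hL x hμν₀ ε hνν₀
  rw [edgesRead_rot_append x μ ν₀ (endpoint_qw x ε hw) Q]
  simp only [List.count_append, List.count_cons, List.count_nil, count_qEdge'_eq_one hL x hνμ ε hw,
    List.count_eq_zero_of_not_mem hQ, beq_iff_eq, Ne.symm h1, Ne.symm h2, Ne.symm h3, Ne.symm h4, if_false]


end CompositeCounts

/-! ## Multipliers: traces of words that do not read the marked link -/

section Multipliers

variable [NeZero L]

/-- **Read-once bound, packaged**: `SU(N)`, `N ≥ 2`, a closed word `W` reading `e` exactly once, a multiplier given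
with its three facts (continuity, ignoring `e`, bound `M`): `‖E[tr hol W · g]‖ ≤ 4(d−1)N²M|β|/(N²−1)`. [folklore] -/
theorem readOnce_suN (hN : 2 ≤ N) (β : ℝ) (z : Site d L) (W : Word d) (hW : Word.endpoint z W = z) (e : Edge d L)
    (hcount : (Word.edgesRead z W).count e = 1)
    {g : GaugeConfig d L (Matrix.specialUnitaryGroup (Fin N) ℂ) → ℂ} {M : ℝ}
    (hg : Continuous g ∧ (∀ (U : GaugeConfig d L (Matrix.specialUnitaryGroup (Fin N) ℂ))
      (h : Matrix.specialUnitaryGroup (Fin N) ℂ), g (Function.update U e h) = g U) ∧ ∀ U, ‖g U‖ ≤ M) :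
    ‖∫ U, (fundamentalRep (Fin N) (wordHolonomy U z W)).trace * g U
        ∂(wilsonMeasure (d := d) (L := L) (fundamentalRep (Fin N)) β)‖ ≤
      4 * ((d : ℝ) - 1) * (N : ℝ) ^ 2 * M * |β| / ((N : ℝ) ^ 2 - 1) :=
  norm_integral_trace_mul_suN_le_of_count_eq_one hN β z W hW e hcount hg.1 hg.2.1 hg.2.2

omit [NeZero L] in
/-- **The trace of a word not reading `e` is a multiplier** (continuous, ignores `e`, bounded by `N`). [folklore] -/
theorem mulData_trace (z : Site d L) (v : Word d) {e : Edge d L} (hv : e ∉ Word.edgesRead z v) :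
    Continuous (fun U : GaugeConfig d L (Matrix.specialUnitaryGroup (Fin N) ℂ) =>
        (fundamentalRep (Fin N) (wordHolonomy U z v)).trace) ∧
      (∀ (U : GaugeConfig d L (Matrix.specialUnitaryGroup (Fin N) ℂ)) (h : Matrix.specialUnitaryGroup (Fin N) ℂ),
        (fundamentalRep (Fin N) (wordHolonomy (Function.update U e h) z v)).trace =
          (fundamentalRep (Fin N) (wordHolonomy U z v)).trace) ∧
      ∀ U : GaugeConfig d L (Matrix.specialUnitaryGroup (Fin N) ℂ), ‖(fundamentalRep (Fin N) (wordHolonomy U z v)).trace‖ ≤ N := by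
  refine ⟨?_, fun U h => by rw [wordHolonomy_update_of_not_mem U e h z v hv], fun U => ?_⟩
  · exact continuous_trace_wordHolonomy (fundamentalLatticeRep N) z v
  · have h := norm_trace_le (fundamentalLatticeRep N) (wordHolonomy U z v)
    exact h

omit [NeZero L] in
/-- **Products of multipliers are multipliers** (bound `M₁·M₂`). [folklore] -/
theorem mulData_mul {G : Type} [TopologicalSpace G] {e : Edge d L} {g₁ g₂ : GaugeConfig d L G → ℂ} {M₁ M₂ : ℝ}
    (h₁ : Continuous g₁ ∧ (∀ (U : GaugeConfig d L G) (h : G), g₁ (Function.update U e h) = g₁ U) ∧ ∀ U, ‖g₁ U‖ ≤ M₁)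
    (h₂ : Continuous g₂ ∧ (∀ (U : GaugeConfig d L G) (h : G), g₂ (Function.update U e h) = g₂ U) ∧ ∀ U, ‖g₂ U‖ ≤ M₂) :
    Continuous (fun U => g₁ U * g₂ U) ∧ (∀ (U : GaugeConfig d L G) (h : G),
      g₁ (Function.update U e h) * g₂ (Function.update U e h) = g₁ U * g₂ U) ∧ ∀ U, ‖g₁ U * g₂ U‖ ≤ M₁ * M₂ := by
  refine ⟨h₁.1.mul h₂.1, fun U h => by rw [h₁.2.1, h₂.2.1], fun U => ?_⟩
  rw [norm_mul]
  exact mul_le_mul (h₁.2.2 U) (h₂.2.2 U) (norm_nonneg _) ((norm_nonneg _).trans (h₁.2.2 U))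

omit [NeZero L] in
/-- The constant `1` is a multiplier (bound `1`). [folklore] -/
theorem mulData_one {G : Type} [TopologicalSpace G] {e : Edge d L} :
    Continuous (fun _ : GaugeConfig d L G => (1 : ℂ)) ∧
      (∀ (U : GaugeConfig d L G) (h : G), (fun _ : GaugeConfig d L G => (1 : ℂ)) (Function.update U e h) =
        (fun _ : GaugeConfig d L G => (1 : ℂ)) U) ∧ ∀ U : GaugeConfig d L G, ‖(fun _ : GaugeConfig d L G => (1 : ℂ)) U‖ ≤ 1 :=
  ⟨continuous_const, fun _ _ => rfl, fun _ => by simp⟩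

end Multipliers

/-! ## The level-3 bounds -/

section Level3

variable [NeZero L]

/-- ★ **Marked `w ∈ {q, q⁻¹}` with any multiplier ignoring `qEdge`**: `‖E[tr hol_x w · g]‖ ≤ 4(d−1)N²M|β|/(N²−1)`.
[folklore] -/
theorem norm_integral_trace_qw_mul_le (hN : 2 ≤ N) (hL : (1 : ZMod L) ≠ 0) (β : ℝ) (x : Site d L) {μ ν : Fin d}
    (hνμ : ν ≠ μ) (ε : Bool) {w : Word d} (hw : w = plaqWord μ ν ε ∨ w = (plaqWord μ ν ε).reverse)
    {g : GaugeConfig d L (Matrix.specialUnitaryGroup (Fin N) ℂ) → ℂ} {M : ℝ}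
    (hg : Continuous g ∧ (∀ (U : GaugeConfig d L (Matrix.specialUnitaryGroup (Fin N) ℂ))
      (h : Matrix.specialUnitaryGroup (Fin N) ℂ), g (Function.update U (qEdge x μ ν ε) h) = g U) ∧ ∀ U, ‖g U‖ ≤ M) :
    ‖∫ U, (fundamentalRep (Fin N) (wordHolonomy U x w)).trace * g U
        ∂(wilsonMeasure (d := d) (L := L) (fundamentalRep (Fin N)) β)‖ ≤
      4 * ((d : ℝ) - 1) * (N : ℝ) ^ 2 * M * |β| / ((N : ℝ) ^ 2 - 1) :=
  readOnce_suN hN β x w (endpoint_qw x ε hw) _ (count_qEdge_eq_one hL x hνμ ε hw) hg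

/-- The `qEdge'` twin (`ν ≠ ν₀`). [folklore] -/
theorem norm_integral_trace_qw_mul_le' (hN : 2 ≤ N) (hL : (1 : ZMod L) ≠ 0) (β : ℝ) (x : Site d L) {μ ν : Fin d}
    (hνμ : ν ≠ μ) (ε : Bool) {w : Word d} (hw : w = plaqWord μ ν ε ∨ w = (plaqWord μ ν ε).reverse)
    {g : GaugeConfig d L (Matrix.specialUnitaryGroup (Fin N) ℂ) → ℂ} {M : ℝ}
    (hg : Continuous g ∧ (∀ (U : GaugeConfig d L (Matrix.specialUnitaryGroup (Fin N) ℂ))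
      (h : Matrix.specialUnitaryGroup (Fin N) ℂ), g (Function.update U (qEdge' x μ ν ε) h) = g U) ∧ ∀ U, ‖g U‖ ≤ M) :
    ‖∫ U, (fundamentalRep (Fin N) (wordHolonomy U x w)).trace * g U
        ∂(wilsonMeasure (d := d) (L := L) (fundamentalRep (Fin N)) β)‖ ≤
      4 * ((d : ℝ) - 1) * (N : ℝ) ^ 2 * M * |β| / ((N : ℝ) ^ 2 - 1) := by
  exact readOnce_suN hN β x w (endpoint_qw x ε hw) _ (count_qEdge'_eq_one hL x hνμ ε hw) hg

/-- ★ **Marked `P̃₀ · w` with any multiplier ignoring `qEdge`**: `‖E[tr hol_x(P̃₀ · w) · g]‖ ≤ 4(d−1)N²M|β|/(N²−1)`.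
[folklore] -/
theorem norm_integral_trace_plaqWord_append_qw_mul_le (hN : 2 ≤ N) (hL : (1 : ZMod L) ≠ 0) (β : ℝ) (x : Site d L) {μ ν₀ ν : Fin d}
    (hμν₀ : μ ≠ ν₀) (hνμ : ν ≠ μ) {ε : Bool} (hne : ¬(ν = ν₀ ∧ ε = true)) {w : Word d}
    (hw : w = plaqWord μ ν ε ∨ w = (plaqWord μ ν ε).reverse)
    {g : GaugeConfig d L (Matrix.specialUnitaryGroup (Fin N) ℂ) → ℂ} {M : ℝ}
    (hg : Continuous g ∧ (∀ (U : GaugeConfig d L (Matrix.specialUnitaryGroup (Fin N) ℂ))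
      (h : Matrix.specialUnitaryGroup (Fin N) ℂ), g (Function.update U (qEdge x μ ν ε) h) = g U) ∧ ∀ U, ‖g U‖ ≤ M) :
    ‖∫ U, (fundamentalRep (Fin N) (wordHolonomy U x (plaqWord μ ν₀ true ++ w))).trace * g U
        ∂(wilsonMeasure (d := d) (L := L) (fundamentalRep (Fin N)) β)‖ ≤
      4 * ((d : ℝ) - 1) * (N : ℝ) ^ 2 * M * |β| / ((N : ℝ) ^ 2 - 1) :=
  readOnce_suN hN β x _ (by rw [Word.endpoint_append, endpoint_plaqWord, endpoint_qw x ε hw]) _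
    (count_qEdge_plaqWord_append hL x hμν₀ hνμ hne hw) hg

/-- ★ **The 12-letter words**: for every plaquette word `Q ∈ {plaqWord ν₀ ν' ε', reverse}` through `(y, ν₀)`, `ν' ≠ ν₀`:
`‖E[tr hol_y(rot w · Q)]‖ ≤ 4(d−1)N²|β|/(N²−1)`. [folklore] -/
theorem norm_integral_trace_rot_append_le (hN : 2 ≤ N) (hL : (1 : ZMod L) ≠ 0) (β : ℝ) (x : Site d L) {μ ν₀ ν : Fin d}
    (hμν₀ : μ ≠ ν₀) (hνμ : ν ≠ μ) {ε : Bool} (hne : ¬(ν = ν₀ ∧ ε = true)) {w : Word d}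
    (hw : w = plaqWord μ ν ε ∨ w = (plaqWord μ ν ε).reverse)
    {ν' : Fin d} (hν'ν₀ : ν' ≠ ν₀) (ε' : Bool) {Q : Word d}
    (hQ : Q = plaqWord ν₀ ν' ε' ∨ Q = (plaqWord ν₀ ν' ε').reverse) :
    ‖∫ U, (fundamentalRep (Fin N) (wordHolonomy U (x.shift μ)
        ((.fwd ν₀ :: .bwd μ :: .bwd ν₀ :: (w ++ [.fwd μ])) ++ Q))).trace
          ∂(wilsonMeasure (d := d) (L := L) (fundamentalRep (Fin N)) β)‖ ≤
      4 * ((d : ℝ) - 1) * (N : ℝ) ^ 2 * |β| / ((N : ℝ) ^ 2 - 1) := by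
  have hcl : Word.endpoint (x.shift μ) ((.fwd ν₀ :: .bwd μ :: .bwd ν₀ :: (w ++ [.fwd μ])) ++ Q) = x.shift μ := by
    rw [Word.endpoint_append, endpoint_rot x μ ν₀ w (endpoint_qw x ε hw), endpoint_qw (x.shift μ) ε' hQ]
  have key : ∀ (e : Edge d L),
      (Word.edgesRead (x.shift μ) ((.fwd ν₀ :: .bwd μ :: .bwd ν₀ :: (w ++ [.fwd μ])) ++ Q)).count e = 1 →
      ‖∫ U, (fundamentalRep (Fin N) (wordHolonomy U (x.shift μ)
          ((.fwd ν₀ :: .bwd μ :: .bwd ν₀ :: (w ++ [.fwd μ])) ++ Q))).trace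
            ∂(wilsonMeasure (d := d) (L := L) (fundamentalRep (Fin N)) β)‖ ≤
        4 * ((d : ℝ) - 1) * (N : ℝ) ^ 2 * |β| / ((N : ℝ) ^ 2 - 1) := fun e he => by
    have h := readOnce_suN hN β (x.shift μ) _ hcl e he (mulData_one (e := e))
    simp only [mul_one] at h
    exact h
  by_cases hc : ν' = ν ∧ ε' = ε
  · obtain ⟨rfl, rfl⟩ := hc
    exact key _ (count_rot_append_eq_one' hL x hμν₀ hνμ ε' (fun h => hν'ν₀ h) hw
      (qEdge'_not_mem_plaqWord₂ x hμν₀ ε' hνμ ε' hQ))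
  · exact key _ (count_rot_append_eq_one hL x hμν₀ hνμ hne hw (qEdge_not_mem_plaqWord₂ hL x hνμ hne hν'ν₀ hc hQ))

/-- ★ **`‖E[tr hol_y(rot w) · tr hol_y Q]‖ ≤ 4(d−1)N³|β|/(N²−1)`** for the same `Q`. [folklore] -/
theorem norm_integral_trace_rot_mul_trace_le (hN : 2 ≤ N) (hL : (1 : ZMod L) ≠ 0) (β : ℝ) (x : Site d L) {μ ν₀ ν : Fin d}
    (hμν₀ : μ ≠ ν₀) (hνμ : ν ≠ μ) {ε : Bool} (hne : ¬(ν = ν₀ ∧ ε = true)) {w : Word d}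
    (hw : w = plaqWord μ ν ε ∨ w = (plaqWord μ ν ε).reverse)
    {ν' : Fin d} (hν'ν₀ : ν' ≠ ν₀) (ε' : Bool) {Q : Word d}
    (hQ : Q = plaqWord ν₀ ν' ε' ∨ Q = (plaqWord ν₀ ν' ε').reverse) :
    ‖∫ U, (fundamentalRep (Fin N) (wordHolonomy U (x.shift μ) (.fwd ν₀ :: .bwd μ :: .bwd ν₀ :: (w ++ [.fwd μ])))).trace *
        (fundamentalRep (Fin N) (wordHolonomy U (x.shift μ) Q)).trace
          ∂(wilsonMeasure (d := d) (L := L) (fundamentalRep (Fin N)) β)‖ ≤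
      4 * ((d : ℝ) - 1) * (N : ℝ) ^ 2 * N * |β| / ((N : ℝ) ^ 2 - 1) := by
  have hcl : Word.endpoint (x.shift μ) (.fwd ν₀ :: .bwd μ :: .bwd ν₀ :: (w ++ [.fwd μ]) : Word d) = x.shift μ :=
    endpoint_rot x μ ν₀ w (endpoint_qw x ε hw)
  have hcnt : ∀ (e : Edge d L),
      (Word.edgesRead (x.shift μ) ((.fwd ν₀ :: .bwd μ :: .bwd ν₀ :: (w ++ [.fwd μ])) ++ [])).count e = 1 →
      (Word.edgesRead (x.shift μ) (.fwd ν₀ :: .bwd μ :: .bwd ν₀ :: (w ++ [.fwd μ]) : Word d)).count e = 1 :=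
    fun e he => by rwa [List.append_nil] at he
  by_cases hc : ν' = ν ∧ ε' = ε
  · obtain ⟨rfl, rfl⟩ := hc
    exact readOnce_suN hN β (x.shift μ) _ hcl _
      (hcnt _ (count_rot_append_eq_one' hL x hμν₀ hνμ ε' (fun h => hν'ν₀ h) hw (Q := []) (by simp)))
      (mulData_trace (x.shift μ) Q (qEdge'_not_mem_plaqWord₂ x hμν₀ ε' hνμ ε' hQ))
  · exact readOnce_suN hN β (x.shift μ) _ hcl _
      (hcnt _ (count_rot_append_eq_one hL x hμν₀ hνμ hne hw (Q := []) (by simp)))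
      (mulData_trace (x.shift μ) Q (qEdge_not_mem_plaqWord₂ hL x hνμ hne hν'ν₀ hc hQ))

/-- ★ **`‖E[tr hol_y(P̃₀ʸ · Q) · tr hol_x w]‖ ≤ 4(d−1)N³|β|/(N²−1)`** (`P̃₀ʸ = plaqWord ν₀ μ false` at `y = x + e_μ`).
[folklore] -/
theorem norm_integral_trace_rebased_append_mul_trace_le (hN : 2 ≤ N) (hL : (1 : ZMod L) ≠ 0) (β : ℝ) (x : Site d L) {μ ν₀ ν : Fin d}
    (hμν₀ : μ ≠ ν₀) (hνμ : ν ≠ μ) {ε : Bool} (hne : ¬(ν = ν₀ ∧ ε = true)) {w : Word d}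
    (hw : w = plaqWord μ ν ε ∨ w = (plaqWord μ ν ε).reverse)
    {ν' : Fin d} (hν'ν₀ : ν' ≠ ν₀) (ε' : Bool) {Q : Word d}
    (hQ : Q = plaqWord ν₀ ν' ε' ∨ Q = (plaqWord ν₀ ν' ε').reverse) :
    ‖∫ U, (fundamentalRep (Fin N) (wordHolonomy U (x.shift μ) (plaqWord ν₀ μ false ++ Q))).trace *
        (fundamentalRep (Fin N) (wordHolonomy U x w)).trace
          ∂(wilsonMeasure (d := d) (L := L) (fundamentalRep (Fin N)) β)‖ ≤
      4 * ((d : ℝ) - 1) * (N : ℝ) ^ 2 * N * |β| / ((N : ℝ) ^ 2 - 1) := by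
  have hsw : ∀ U : GaugeConfig d L (Matrix.specialUnitaryGroup (Fin N) ℂ),
      (fundamentalRep (Fin N) (wordHolonomy U (x.shift μ) (plaqWord ν₀ μ false ++ Q))).trace *
        (fundamentalRep (Fin N) (wordHolonomy U x w)).trace =
      (fundamentalRep (Fin N) (wordHolonomy U x w)).trace *
        (fundamentalRep (Fin N) (wordHolonomy U (x.shift μ) (plaqWord ν₀ μ false ++ Q))).trace := fun U => mul_comm _ _
  simp_rw [hsw]
  have hread : ∀ {e : Edge d L}, e ∉ Word.edgesRead (x.shift μ) (plaqWord ν₀ μ false) → e ∉ Word.edgesRead (x.shift μ) Q →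
      e ∉ Word.edgesRead (x.shift μ) (plaqWord ν₀ μ false ++ Q) := fun h1 h2 => by
    rw [Word.edgesRead_append, endpoint_plaqWord]
    exact List.not_mem_append h1 h2
  by_cases hc : ν' = ν ∧ ε' = ε
  · obtain ⟨rfl, rfl⟩ := hc
    have hνν₀ : ν' ≠ ν₀ := hν'ν₀
    exact norm_integral_trace_qw_mul_le' hN hL β x hνμ ε' hw
      (mulData_trace (x.shift μ) _ (hread (qEdge'_not_mem_plaqWordZero hL x hμν₀ ε' hνν₀).2.2.1
        (qEdge'_not_mem_plaqWord₂ x hμν₀ ε' hνμ ε' hQ)))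
  · exact norm_integral_trace_qw_mul_le hN hL β x hνμ ε hw
      (mulData_trace (x.shift μ) _ (hread (qEdge_not_mem_plaqWordZero hL x hμν₀ hνμ hne).2.2.1
        (qEdge_not_mem_plaqWord₂ hL x hνμ hne hν'ν₀ hc hQ)))

/-- ★ **`‖E[tr hol_y P̃₀ʸ · tr hol_y Q · tr hol_x w]‖ ≤ 4(d−1)N⁴|β|/(N²−1)`**. [folklore] -/
theorem norm_integral_trace_rebased_mul_trace_mul_trace_le (hN : 2 ≤ N) (hL : (1 : ZMod L) ≠ 0) (β : ℝ) (x : Site d L) {μ ν₀ ν : Fin d}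
    (hμν₀ : μ ≠ ν₀) (hνμ : ν ≠ μ) {ε : Bool} (hne : ¬(ν = ν₀ ∧ ε = true)) {w : Word d}
    (hw : w = plaqWord μ ν ε ∨ w = (plaqWord μ ν ε).reverse)
    {ν' : Fin d} (hν'ν₀ : ν' ≠ ν₀) (ε' : Bool) {Q : Word d}
    (hQ : Q = plaqWord ν₀ ν' ε' ∨ Q = (plaqWord ν₀ ν' ε').reverse) :
    ‖∫ U, (fundamentalRep (Fin N) (wordHolonomy U (x.shift μ) (plaqWord ν₀ μ false))).trace *
        (fundamentalRep (Fin N) (wordHolonomy U (x.shift μ) Q)).trace *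
        (fundamentalRep (Fin N) (wordHolonomy U x w)).trace
          ∂(wilsonMeasure (d := d) (L := L) (fundamentalRep (Fin N)) β)‖ ≤
      4 * ((d : ℝ) - 1) * (N : ℝ) ^ 2 * (N * N) * |β| / ((N : ℝ) ^ 2 - 1) := by
  have hsw : ∀ U : GaugeConfig d L (Matrix.specialUnitaryGroup (Fin N) ℂ),
      (fundamentalRep (Fin N) (wordHolonomy U (x.shift μ) (plaqWord ν₀ μ false))).trace *
        (fundamentalRep (Fin N) (wordHolonomy U (x.shift μ) Q)).trace *
        (fundamentalRep (Fin N) (wordHolonomy U x w)).trace =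
      (fundamentalRep (Fin N) (wordHolonomy U x w)).trace *
        ((fundamentalRep (Fin N) (wordHolonomy U (x.shift μ) (plaqWord ν₀ μ false))).trace *
          (fundamentalRep (Fin N) (wordHolonomy U (x.shift μ) Q)).trace) := fun U => by ring
  simp_rw [hsw]
  by_cases hc : ν' = ν ∧ ε' = ε
  · obtain ⟨rfl, rfl⟩ := hc
    have hνν₀ : ν' ≠ ν₀ := hν'ν₀
    exact norm_integral_trace_qw_mul_le' hN hL β x hνμ ε' hw
      (mulData_mul (mulData_trace (x.shift μ) _ (qEdge'_not_mem_plaqWordZero hL x hμν₀ ε' hνν₀).2.2.1)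
        (mulData_trace (x.shift μ) _ (qEdge'_not_mem_plaqWord₂ x hμν₀ ε' hνμ ε' hQ)))
  · exact norm_integral_trace_qw_mul_le hN hL β x hνμ ε hw
      (mulData_mul (mulData_trace (x.shift μ) _ (qEdge_not_mem_plaqWordZero hL x hμν₀ hνμ hne).2.2.1)
        (mulData_trace (x.shift μ) _ (qEdge_not_mem_plaqWord₂ hL x hνμ hne hν'ν₀ hc hQ)))

end Level3

end StrongCoupling

end Summit.QuantumFields.GaugeBoot

end
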